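import Literature.AlgebraicGeometry.Morphisms.CechModuleShortExact
import HarnessLib

/-!
# Affine-localizing modules: kernels, extensions, quotients, isomorphisms

Closure properties of the affine-local property `IsAffineLocalizing`
(`Literature/AlgebraicGeometry/Modules/AffineLocalizing`: numerators and torsion on the principal
opens of affine opens — EGA I Thm. 1.4.1 d1), d2); Hartshorne II Lemma 5.3) under the operations of a
dévissage, proved by diagram chases on sections (The Stacks Project, Tag 01LA: kernels, cokernels and
extensions of quasi-coherent modules are quasi-coherent; Hartshorne II Prop. 5.7; Görtz–Wedhorn I,
Cor. 7.19), using the left exactness of sections (`Modules/SectionsExact`) and, for quotients and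
extensions, the right exactness on affine opens for an affine-localizing kernel
(`Morphisms/CechModuleShortExact`, Hartshorne II Prop. 5.6):

* `IsAffineLocalizing.of_iso` — invariance under isomorphisms;
* `IsAffineLocalizing.kernel` — the kernel of a morphism between affine-localizing modules;
* `IsAffineLocalizing.of_shortExact₃` — the quotient `M''` of `0 → M' → M → M'' → 0` with `M'`, `M`
  affine-localizing;
* `IsAffineLocalizing.of_shortExact₂` — the extension `M` with `M'`, `M''` affine-localizing.

Everything is proved; no named facts. Mathlib searched (pin v4.32): `Scheme.Modules.Hom.app_smul`,
`Scheme.Modules.map_smul`, `IsAffineOpen.basicOpen` (used); Mathlib has no closure statements for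
quasi-coherence under kernels/cokernels on schemes.

## References

* The Stacks Project, Tag 01LA (Schemes, Section 26.24: quasi-coherent sheaves form an abelian
  subcategory closed under extensions). [StacksProject]
* R. Hartshorne, *Algebraic Geometry*, GTM 52 (1977): II Lemma 5.3, Prop. 5.6, Prop. 5.7 (pp. 112–114).
  [Hartshorne1977]
-/

noncomputable section

open CategoryTheory AlgebraicGeometry Limits TopologicalSpace Opposite
open Literature.AlgebraicGeometry.Morphisms

universe u

namespace Literature.AlgebraicGeometry.Modules

variable {X : Scheme.{u}}

/-! ## Section-level bookkeeping -/

/-- Morphisms of sheaves of modules commute with restriction (elementwise). [folklore] -/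
theorem map_app {M N : X.Modules} (φ : M ⟶ N) {V W : X.Opens} (h : W ≤ V) (m : Γ(M, V)) :
    N.presheaf.map (homOfLE h).op (φ.app V m) = φ.app W (M.presheaf.map (homOfLE h).op m) :=
  (ConcreteCategory.congr_hom (φ.mapPresheaf.naturality (homOfLE h).op) m).symm

/-- `(e.hom ∘ e.inv)` is the identity on sections. [folklore] -/
theorem hom_app_inv_app {M N : X.Modules} (e : M ≅ N) (V : X.Opens) (x : Γ(N, V)) :
    e.hom.app V (e.inv.app V x) = x := by
  change (e.inv ≫ e.hom).app V x = x
  rw [e.inv_hom_id]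
  rfl

/-- `(e.inv ∘ e.hom)` is the identity on sections. [folklore] -/
theorem inv_app_hom_app {M N : X.Modules} (e : M ≅ N) (V : X.Opens) (x : Γ(M, V)) :
    e.inv.app V (e.hom.app V x) = x := by
  change (e.hom ≫ e.inv).app V x = x
  rw [e.hom_inv_id]
  rfl

namespace IsAffineLocalizing

/-! ## Isomorphisms -/

/-- Affine-localizing is invariant under isomorphisms. [folklore] -/
theorem of_iso {M N : X.Modules} (e : M ≅ N) (hM : IsAffineLocalizing M) : IsAffineLocalizing N := by
  constructor
  · intro V hV r W hW s
    obtain ⟨n, x, hx⟩ := hM.numerator hV r hW (e.inv.app W s)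
    refine ⟨n, e.hom.app V x, ?_⟩
    rw [map_app, hx, Scheme.Modules.Hom.app_smul, hom_app_inv_app]
  · intro V hV r x W hWV hrW hx
    obtain ⟨n, hn⟩ := hM.torsion hV r (e.inv.app V x) hWV hrW
      (by rw [map_app, hx, map_zero])
    refine ⟨n, ?_⟩
    rw [← hom_app_inv_app e V x, ← Scheme.Modules.Hom.app_smul, hn, map_zero]

/-! ## Kernels -/

/-- **The kernel of a morphism between affine-localizing modules is affine-localizing**
(Stacks 01LA / Hartshorne II Prop. 5.7: kernels of quasi-coherent are quasi-coherent): numerators —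
for `s ∈ Γ(D(r), ker φ)`, `r^a s = x|` in `M`, and `φ(x)| = 0` forces `r^b φ(x) = 0`, so
`r^{a+b} s = (r^b x)|` with `r^b x ∈ ker φ`; torsion is inherited from `M`.
[cite: Hartshorne1977, II Prop. 5.7 (p. 114)] -/
theorem kernel {M N : X.Modules} (φ : M ⟶ N) (hM : IsAffineLocalizing M) (hN : IsAffineLocalizing N) :
    IsAffineLocalizing (Limits.kernel φ) := by
  constructor
  · intro V hV r W hW s
    have hι := hW.le.trans (X.basicOpen_le r)
    obtain ⟨a, x, hx⟩ := hM.numerator hV r hW ((kernel.ι φ).app W s)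
    -- `φ x` vanishes on `W = D(r)`, hence `r^b • φ x = 0`
    obtain ⟨b, hb⟩ := hN.torsion hV r (φ.app V x) hι (hW ▸ le_rfl) (by
      rw [map_app, hx, Scheme.Modules.Hom.app_smul, app_kernel_ι_app, smul_zero])
    -- so `r^b • x ∈ ker φ`
    obtain ⟨k, hk⟩ := exists_kernel_ι_app_eq φ V (r ^ b • x)
      (by rw [Scheme.Modules.Hom.app_smul, hb])
    refine ⟨a + b, k, kernel_ι_app_injective φ W ?_⟩
    rw [← map_app, hk, Scheme.Modules.map_smul, hx, Scheme.Modules.Hom.app_smul, smul_smul, ← map_pow,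
      ← map_mul, ← pow_add, add_comm, map_pow]
  · intro V hV r x W hWV hrW hx
    obtain ⟨n, hn⟩ := hM.torsion hV r ((kernel.ι φ).app V x) hWV hrW
      (by rw [map_app, hx, map_zero])
    refine ⟨n, kernel_ι_app_injective φ V ?_⟩
    rw [Scheme.Modules.Hom.app_smul, hn, map_zero]


/-! ## Quotients and extensions -/

/-- **The quotient in a short exact sequence `0 → M' → M → M'' → 0` with `M'`, `M` affine-localizing is
affine-localizing** (Stacks 01LA; cokernels of quasi-coherent are quasi-coherent): numerators are
pushed down from `M` (sections of `M''` over the affine `D(r)` lift to `M`, Hartshorne II Prop. 5.6);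
for torsion, `x'' = ψ x` with `x|_W ∈ im φ`, and `φ`'s numerators plus `M`'s torsion give
`r^{a+b} x ∈ im φ`. [cite: Hartshorne1977, II Prop. 5.7 (p. 114) with Prop. 5.6 (p. 113)] -/
theorem of_shortExact₃ {S : ShortComplex X.Modules} (hS : S.ShortExact) (h₁ : IsAffineLocalizing S.X₁)
    (h₂ : IsAffineLocalizing S.X₂) : IsAffineLocalizing S.X₃ := by
  constructor
  · intro V hV r W hW s
    have hWaff : IsAffineOpen W := hW ▸ hV.basicOpen r
    obtain ⟨m, rfl⟩ := app_surjective_of_shortExact hS h₁ hWaff s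
    obtain ⟨a, x, hx⟩ := h₂.numerator hV r hW m
    refine ⟨a, S.g.app V x, ?_⟩
    rw [map_app, hx, Scheme.Modules.Hom.app_smul]
  · intro V hV r x'' W hWV hrW hx''
    obtain ⟨x, rfl⟩ := app_surjective_of_shortExact hS h₁ hV x''
    -- `x|_W ∈ im φ`
    obtain ⟨y, hy⟩ := (sections_exact_of_shortExact hS W).2 (S.X₂.presheaf.map (homOfLE hWV).op x)
      (by rw [← map_app, hx''])
    -- numerators for `y` on `D(r)`
    have hDW : X.basicOpen r ≤ W := hrW
    have hDV : X.basicOpen r ≤ V := X.basicOpen_le r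
    obtain ⟨a, y₀, hy₀⟩ := h₁.numerator hV r rfl (S.X₁.presheaf.map (homOfLE hDW).op y)
    -- `r^a • x - φ y₀` vanishes on `D(r)`
    obtain ⟨b, hb⟩ := h₂.torsion hV r (r ^ a • x - S.f.app V y₀) hDV le_rfl (by
      have e1 : S.X₂.presheaf.map (homOfLE hDV).op x =
          S.f.app _ (S.X₁.presheaf.map (homOfLE hDW).op y) := by
        rw [← map_app, hy, map_map]
        exact map_eq_map _ _ _ _
      rw [map_sub, Scheme.Modules.map_smul, e1, map_app, hy₀, Scheme.Modules.Hom.app_smul, map_pow,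
        sub_self])
    refine ⟨b + a, ?_⟩
    rw [pow_add, mul_smul, ← Scheme.Modules.Hom.app_smul, ← Scheme.Modules.Hom.app_smul,
      show r ^ b • r ^ a • x = S.f.app V (r ^ b • y₀) by
        rw [Scheme.Modules.Hom.app_smul, ← sub_eq_zero, ← smul_sub, hb],
      app_app_eq_zero]

/-- **The middle term of a short exact sequence `0 → M' → M → M'' → 0` with `M'`, `M''` affine-localizing
is affine-localizing** (Stacks 01LA: extensions of quasi-coherent modules are quasi-coherent).
[cite: Hartshorne1977, II Prop. 5.7 (p. 114) with Prop. 5.6 (p. 113)] -/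
theorem of_shortExact₂ {S : ShortComplex X.Modules} (hS : S.ShortExact) (h₁ : IsAffineLocalizing S.X₁)
    (h₃ : IsAffineLocalizing S.X₃) : IsAffineLocalizing S.X₂ := by
  constructor
  · intro V hV r W hW m
    have hι : W ≤ V := hW.le.trans (X.basicOpen_le r)
    -- numerators for `ψ m`
    obtain ⟨a, x'', hx''⟩ := h₃.numerator hV r hW (S.g.app W m)
    obtain ⟨x₁, rfl⟩ := app_surjective_of_shortExact hS h₁ hV x''
    -- `x₁|_W - r^a m ∈ im φ`
    obtain ⟨y, hy⟩ := (sections_exact_of_shortExact hS W).2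
      (S.X₂.presheaf.map (homOfLE hι).op x₁ - X.presheaf.map (homOfLE hι).op r ^ a • m)
      (by rw [map_sub, ← map_app, hx'', Scheme.Modules.Hom.app_smul, sub_self])
    obtain ⟨b, y₀, hy₀⟩ := h₁.numerator hV r hW y
    refine ⟨a + b, r ^ b • x₁ - S.f.app V y₀, ?_⟩
    rw [map_sub, Scheme.Modules.map_smul, map_pow, map_app, hy₀, Scheme.Modules.Hom.app_smul, hy,
      smul_sub, sub_sub_cancel, smul_smul, ← pow_add, add_comm]
  · intro V hV r x W hWV hrW hx
    obtain ⟨a, ha⟩ := h₃.torsion hV r (S.g.app V x) hWV hrW (by rw [map_app, hx, map_zero])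
    obtain ⟨y, hy⟩ := (sections_exact_of_shortExact hS V).2 (r ^ a • x)
      (by rw [Scheme.Modules.Hom.app_smul, ha])
    obtain ⟨b, hb⟩ := h₁.torsion hV r y hWV hrW ((sections_exact_of_shortExact hS W).1 (by
      rw [← map_app, hy, Scheme.Modules.map_smul, hx, smul_zero, map_zero]))
    refine ⟨b + a, ?_⟩
    rw [pow_add, mul_smul, ← hy, ← Scheme.Modules.Hom.app_smul, hb, map_zero]

end IsAffineLocalizing

end Literature.AlgebraicGeometry.Modules

end
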